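import Summits.AtomisticToContinuum.HydrodynamicLimit.Theses.OneFlightGossipEngine
import Summits.AtomisticToContinuum.HydrodynamicLimit.Theorems.OneFlightGossipEngineClampedCurrentsDockKineticInstanceClass
import HarnessLib

/-!
# The kinetic instance KC1 (stub `stub_kineticInstance`, line `IdeatorTwoSketch`, crux
# `ClampedCurrentsDock`, stmt-AtomisticToContinuum-14680)

Helper file (`--supports stmt-AtomisticToContinuum-14680`) proving the registered stub
`stub_kineticInstance : KineticInstance` (KC1) of the lead's skeleton
(`Cruxes/ClampedCurrentsDock/Lines/IdeatorTwoSketch.lean`, §1c): the kinetic window LD along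
families (`KineticCurrentsWindowLDFamily`, hypothesis 1) applied along a reference family
`(a, θ, u)` given only on the slab `[0, t₁] × 𝕋³`, with the re-orthogonalised low-speed heat-flux
cut-off along families (`LoHeatFluxCutoffFamily`, hypothesis 2), to the class member generated by
the Euler cancellation S8: the traceless kinetic stress plus the LOW part of the heat flux,
`lo_s(x,v) = θ⁻¹Σ_{j,k}(w_jw_k − δ_{jk}|w|²/3)∂_k u_j + (Σ_k ∂_kθ/(2θ²) w_k) G_s(x,|w|²)`, `w = v − u_s(x)`.

Proof (docstring of `KineticInstance`):
* CLAMP the parameter to the slab, `p s = max 0 (min t₁ s)`: the clamped families are globally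
  jointly continuous, positive, with global bounds by compactness of `[0,t₁] × 𝕋³`
  (joint continuity of the space derivatives on the slab from `Torus.IsSmoothSpaceTimeOn.partialDeriv`
  for `t₁ > 0`, from smoothness of the single slice for `t₁ = 0`; passage from the space–time lift
  to `ℝ × 𝕋³` by the tree's `Torus.continuousOn_uncurry_of_continuousOn_stLift`);
* the coefficient families `A_{jk} = θ⁻¹(∂_k u_j − δ_{jk} div u/3)` (TRACELESS) and
  `b_k = ∂_kθ/(2θ²)`, clamped; `G` from hypothesis 2 for `(θ̃, ũ, b̃)` and `K⋆`;
* the class hypotheses of KCWU: class bound from boundedness of `A`, `u` and the class-bound clause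
  of hypothesis 2; orthogonality of the flux part `(b·w)G` by hypothesis 2, of the traceless
  quadratic part by the Gaussian moment identities of the ClassTruncation toolkit
  (`integral_classForm_mul_even/coord`: `∫ Q M = θ tr A E[ξ₀²] = 0`, odd first moments,
  `∫ Q |ξ|² = θ tr A E[ξ₀²|ξ|²] = 0`), transported to the Maxwellian variable for functionals of
  quadratic growth; sums of orthogonal functionals in the reduced Gaussian variable;
* read the conclusion of hypothesis 1 at `s ∈ [0,t₁]`, where the clamped families are the given
  ones and `Σ A_{jk} w_j w_k = θ⁻¹ Σ (w_jw_k − δ_{jk}|w|²/3) ∂_k u_j` (`traceless_form`).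

The deterministic toolkit (Gaussian moments of the class member, slab calculus, the traceless
algebra) is the periphery file `OneFlightGossipEngineClampedCurrentsDockKineticInstanceClass.lean`.
-/

noncomputable section

namespace Summit.AtomisticToContinuum.HydrodynamicLimit.Theorems.ClampedCurrentsDockKineticInstance

open scoped BigOperators ENNReal Classical Interval
open MeasureTheory Filter Set Topology InformationTheory
open Literature.MathematicalPhysics.KineticTheory Literature.Analysis.FluidPDE Literature.Analysis.FunctionSpaces
open Summit.AtomisticToContinuum.HydrodynamicLimit.Theses.OneFlightGossipEngine
open ProbabilityTheory
open Summit.AtomisticToContinuum.HydrodynamicLimit.Theorems.KineticCurrentsWindowLDUniformSketch.ClassTruncation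

/-! ## The statements (verbatim from the registered skeleton) -/

/-- registered stub signature (hypothesis 1 of KC1: KCWU along families) of line IdeatorTwoSketch, crux
ClampedCurrentsDock — route-internal, not a cited fact -/
def KineticCurrentsWindowLDFamily : Prop :=
  ∃ η₀ : ℝ, 0 < η₀ ∧ ∀ (t₁ : ℝ) (a θ₀ : ℝ → T3 → ℝ) (u₀ : ℝ → T3 → V3),
    Continuous (Function.uncurry a) → Continuous (Function.uncurry θ₀) → Continuous (Function.uncurry u₀) →
    (∀ s x, 0 < a s x) → (∀ s x, 0 < θ₀ s x) →
    ∀ σ : ℝ, 0 < σ → (∀ s ∈ Set.Icc 0 t₁, σ ^ 3 * (⨆ x, a s x) ≤ η₀ * ∫ x, a s x) →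
    ∀ Φ : (N : ℕ) → HardSphereFlow (Torus.geometry (Fin 3)) (hsDiameter σ N) (N + 1),
    ∀ (A : ℝ → T3 → Fin 3 → Fin 3 → ℝ) (b : ℝ → T3 → V3) (G : ℝ → T3 × ℝ → ℝ),
    Continuous (Function.uncurry A) → Continuous (Function.uncurry b) → Continuous (Function.uncurry G) →
    (let F := fun (s : ℝ) (y : T3 × V3) =>
       (∑ j : Fin 3, ∑ k : Fin 3, A s y.1 j k * ((y.2 - u₀ s y.1) j * (y.2 - u₀ s y.1) k)) +
         (∑ j : Fin 3, b s y.1 j * (y.2 - u₀ s y.1) j) * G s (y.1, ‖y.2 - u₀ s y.1‖ ^ 2)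
     (∃ C : ℝ, ∀ s ∈ Set.Icc 0 t₁, ∀ y : T3 × V3, |F s y| ≤ C * (1 + ‖y.2‖ ^ 2)) →
     (∀ s ∈ Set.Icc 0 t₁, ∀ x, ∫ v, F s (x, v) * localMaxwellian 1 (θ₀ s x) (u₀ s x) v = 0) →
     (∀ s ∈ Set.Icc 0 t₁, ∀ x (j : Fin 3),
        ∫ v, F s (x, v) * v j * localMaxwellian 1 (θ₀ s x) (u₀ s x) v = 0) →
     (∀ s ∈ Set.Icc 0 t₁, ∀ x, ∫ v, F s (x, v) * ‖v‖ ^ 2 * localMaxwellian 1 (θ₀ s x) (u₀ s x) v = 0) →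
     ∃ β₀ : ℝ, 0 < β₀ ∧ ∀ β : ℝ, |β| ≤ β₀ → ∀ ε : ℝ, 0 < ε → ∃ τ₀ : ℝ, 0 < τ₀ ∧ ∀ τ : ℝ, τ₀ ≤ τ →
     ∃ N₀ : ℕ, ∀ N : ℕ, N₀ ≤ N → ∀ s ∈ Set.Icc 0 t₁,
       ∫⁻ z, ENNReal.ofReal (Real.exp (β * ∑ i : Fin (N + 1),
           (τ * ((N : ℝ) + 1) ^ (-(1 / 3 : ℝ)))⁻¹ *
             ∫ r in (0 : ℝ)..(τ * ((N : ℝ) + 1) ^ (-(1 / 3 : ℝ))), F s ((Φ N).flow r z i)))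
         ∂(localGibbsLaw σ (a s) (u₀ s) (θ₀ s) N (Φ N)) ≤
       ENNReal.ofReal (Real.exp (ε * ((N : ℝ) + 1))))

/-- registered stub signature (hypothesis 2 of KC1: the re-orthogonalised low-speed heat-flux cut-off along
families, S11F) of line IdeatorTwoSketch, crux ClampedCurrentsDock — route-internal, not a cited fact -/
def LoHeatFluxCutoffFamily : Prop :=
  ∀ (θ₀ : ℝ → T3 → ℝ) (u₀ b : ℝ → T3 → V3), Continuous (Function.uncurry θ₀) →
    Continuous (Function.uncurry u₀) → Continuous (Function.uncurry b) →
    (∃ θm : ℝ, 0 < θm ∧ ∀ s x, θm ≤ θ₀ s x) → (∃ θM : ℝ, ∀ s x, θ₀ s x ≤ θM) →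
    (∃ U : ℝ, ∀ s x, ‖u₀ s x‖ ≤ U) → (∃ Bb : ℝ, ∀ s x, ‖b s x‖ ≤ Bb) →
    ∀ Kstar : ℝ, 0 < Kstar → ∃ G : ℝ → T3 × ℝ → ℝ, Continuous (Function.uncurry G) ∧
      (∃ C : ℝ, ∀ (s : ℝ) (y : T3 × ℝ), 0 ≤ y.2 → |G s y| ≤ C) ∧
      (∀ (s : ℝ) (x : T3) (s' : ℝ), s' ≤ Kstar ^ 2 → G s (x, s') = s' - 5 * θ₀ s x) ∧
      (∃ C : ℝ, ∀ (s : ℝ) (y : T3 × V3),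
        |(∑ j : Fin 3, b s y.1 j * (y.2 - u₀ s y.1) j) * G s (y.1, ‖y.2 - u₀ s y.1‖ ^ 2)| ≤ C * (1 + ‖y.2‖ ^ 2)) ∧
      (∀ s x, ∫ v, ((∑ j : Fin 3, b s x j * (v - u₀ s x) j) * G s (x, ‖v - u₀ s x‖ ^ 2)) *
        localMaxwellian 1 (θ₀ s x) (u₀ s x) v = 0) ∧
      (∀ s x (k : Fin 3), ∫ v, ((∑ j : Fin 3, b s x j * (v - u₀ s x) j) * G s (x, ‖v - u₀ s x‖ ^ 2)) * v k *
        localMaxwellian 1 (θ₀ s x) (u₀ s x) v = 0) ∧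
      (∀ s x, ∫ v, ((∑ j : Fin 3, b s x j * (v - u₀ s x) j) * G s (x, ‖v - u₀ s x‖ ^ 2)) * ‖v‖ ^ 2 *
        localMaxwellian 1 (θ₀ s x) (u₀ s x) v = 0)

/-- registered stub signature KC1 (`stub_kineticInstance`) of line IdeatorTwoSketch, crux ClampedCurrentsDock —
route-internal, not a cited fact -/
def KineticInstance : Prop :=
  KineticCurrentsWindowLDFamily → LoHeatFluxCutoffFamily →
  ∃ ηK : ℝ, 0 < ηK ∧ ∀ (t₁ : ℝ) (a θ : ℝ → T3 → ℝ) (u : ℝ → T3 → V3), 0 ≤ t₁ →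
    ContinuousOn (Function.uncurry a) (Set.Icc 0 t₁ ×ˢ Set.univ) → (∀ s ∈ Set.Icc 0 t₁, ∀ x, 0 < a s x) →
    Torus.IsSmoothSpaceTimeOn (Set.Icc 0 t₁) θ → Torus.IsSmoothSpaceTimeOn (Set.Icc 0 t₁) u →
    (∀ s ∈ Set.Icc 0 t₁, ∀ x, 0 < θ s x) →
    ∀ σ : ℝ, 0 < σ → (∀ s ∈ Set.Icc 0 t₁, σ ^ 3 * (⨆ x, a s x) ≤ ηK * ∫ x, a s x) →
    ∀ Φ : (N : ℕ) → HardSphereFlow (Torus.geometry (Fin 3)) (hsDiameter σ N) (N + 1),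
    ∀ Kstar : ℝ, 0 < Kstar →
    ∃ G : ℝ → T3 × ℝ → ℝ, ContinuousOn (Function.uncurry G) (Set.Icc 0 t₁ ×ˢ Set.univ) ∧
      (∃ C : ℝ, ∀ s ∈ Set.Icc 0 t₁, ∀ y : T3 × ℝ, 0 ≤ y.2 → |G s y| ≤ C) ∧
      (∀ s ∈ Set.Icc 0 t₁, ∀ (x : T3) (s' : ℝ), s' ≤ Kstar ^ 2 → G s (x, s') = s' - 5 * θ s x) ∧
      ∃ β₀ : ℝ, 0 < β₀ ∧ ∀ β : ℝ, |β| ≤ β₀ → ∀ ε : ℝ, 0 < ε → ∃ τ₀ : ℝ, 0 < τ₀ ∧ ∀ τ : ℝ, τ₀ ≤ τ →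
      ∃ N₀ : ℕ, ∀ N : ℕ, N₀ ≤ N → ∀ s ∈ Set.Icc 0 t₁,
        (let lo := fun (s : ℝ) (y : T3 × V3) =>
           (θ s y.1)⁻¹ * ∑ j : Fin 3, ∑ k : Fin 3,
               ((y.2 - u s y.1) j * (y.2 - u s y.1) k - (if j = k then ‖y.2 - u s y.1‖ ^ 2 / 3 else 0)) *
                 Torus.partialDeriv k (fun x => u s x j) y.1 +
             (∑ k : Fin 3, Torus.partialDeriv k (θ s) y.1 / (2 * (θ s y.1) ^ 2) * (y.2 - u s y.1) k) *
               G s (y.1, ‖y.2 - u s y.1‖ ^ 2)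
         ∫⁻ z, ENNReal.ofReal (Real.exp (β * ∑ i : Fin (N + 1),
             (τ * ((N : ℝ) + 1) ^ (-(1 / 3 : ℝ)))⁻¹ *
               ∫ r in (0 : ℝ)..(τ * ((N : ℝ) + 1) ^ (-(1 / 3 : ℝ))), lo s ((Φ N).flow r z i)))
           ∂(localGibbsLaw σ (a s) (u s) (θ s) N (Φ N)) ≤
         ENNReal.ofReal (Real.exp (ε * ((N : ℝ) + 1))))


/-! ## The stub -/

/-- **KC1 — the kinetic instance** (registered stub `stub_kineticInstance` of line IdeatorTwoSketch,
crux ClampedCurrentsDock): KCWU along families, applied along the reference family clamped to the slab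
`[0,t₁]` with the re-orthogonalised cut-off of S11-family and the traceless-stress/low-heat-flux class
member, read on the slab. [folklore] -/
theorem stub_kineticInstance : KineticInstance := by
  intro hK hL
  obtain ⟨η₀, hη₀, hKC⟩ := hK
  refine ⟨η₀, hη₀, ?_⟩
  intro t₁ a θ u ht₁ hac hapos hθ hu hθpos σ hσ hguard Φ Kstar hKstar
  -- (i) the clamp `p s = max 0 (min t₁ s)`
  obtain ⟨p, hp⟩ : ∃ p : ℝ → ℝ, p = fun s => max 0 (min t₁ s) := ⟨_, rfl⟩
  have hpc : Continuous p := by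
    rw [hp]; exact continuous_const.max (continuous_const.min continuous_id)
  have hpm : ∀ s, p s ∈ Icc 0 t₁ := fun s => by
    rw [hp]; exact ⟨le_max_left _ _, max_le ht₁ (min_le_left _ _)⟩
  have hpid : ∀ s ∈ Icc 0 t₁, p s = s := fun s hs => by
    rw [hp]; show max 0 (min t₁ s) = s; rw [min_eq_right hs.2, max_eq_right hs.1]
  -- slab continuity of the data and of their space derivatives
  have hθc0 : ContinuousOn (Function.uncurry θ) (Icc 0 t₁ ×ˢ univ) :=
    Torus.continuousOn_uncurry_of_continuousOn_stLift hθ.continuousOn_stLift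
  have huc0 : ContinuousOn (Function.uncurry u) (Icc 0 t₁ ×ˢ univ) :=
    Torus.continuousOn_uncurry_of_continuousOn_stLift hu.continuousOn_stLift
  have hDθ0 : ∀ k : Fin 3, ContinuousOn
      (Function.uncurry fun s x => Torus.partialDeriv k (θ s) x) (Icc 0 t₁ ×ˢ univ) :=
    fun k => continuousOn_partialDeriv_slab ht₁ hθ k
  have hDu0 : ∀ j k : Fin 3, ContinuousOn
      (Function.uncurry fun s x => Torus.partialDeriv k (fun y => u s y j) x) (Icc 0 t₁ ×ˢ univ) :=
    fun j k => continuousOn_partialDeriv_slab ht₁ (hu.apply j) k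
  -- bounds on the slab
  obtain ⟨θm, hθm0, hθm⟩ := exists_pos_le_slab ht₁ hθc0 hθpos
  obtain ⟨θM, hθM⟩ := exists_abs_le_slab hθc0
  obtain ⟨U, hU⟩ := hu.exists_norm_le_of_isCompact isCompact_Icc subset_rfl
  choose Mθ hMθ using fun k : Fin 3 => exists_abs_le_slab (hDθ0 k)
  choose Mu hMu using fun j k : Fin 3 => exists_abs_le_slab (hDu0 j k)
  obtain ⟨MD, hMD0, hMθ', hMu'⟩ : ∃ MD : ℝ, 0 ≤ MD ∧
      (∀ k, ∀ s ∈ Icc 0 t₁, ∀ x, |Torus.partialDeriv k (θ s) x| ≤ MD) ∧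
      (∀ j k, ∀ s ∈ Icc 0 t₁, ∀ x, |Torus.partialDeriv k (fun y => u s y j) x| ≤ MD) := by
    refine ⟨(∑ k, |Mθ k|) + ∑ j, ∑ k, |Mu j k|, by positivity, fun k s hs x => ?_,
      fun j k s hs x => ?_⟩
    · have h1 : |Mθ k| ≤ ∑ k, |Mθ k| :=
        Finset.single_le_sum (fun i _ => abs_nonneg (Mθ i)) (Finset.mem_univ k)
      have h2 : 0 ≤ ∑ j, ∑ k, |Mu j k| := by positivity
      linarith [hMθ k s hs x, le_abs_self (Mθ k)]
    · have h1 : |Mu j k| ≤ ∑ k, |Mu j k| :=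
        Finset.single_le_sum (fun i _ => abs_nonneg (Mu j i)) (Finset.mem_univ k)
      have h2 : ∑ k, |Mu j k| ≤ ∑ j, ∑ k, |Mu j k| :=
        Finset.single_le_sum (f := fun j => ∑ k, |Mu j k|)
          (fun i _ => Finset.sum_nonneg fun k _ => abs_nonneg (Mu i k)) (Finset.mem_univ j)
      have h3 : 0 ≤ ∑ k, |Mθ k| := by positivity
      linarith [hMu j k s hs x, le_abs_self (Mu j k)]
  -- the clamped families and the clamped coefficient families
  set θc : ℝ → T3 → ℝ := fun s x => θ (p s) x with hθc_def
  set uc : ℝ → T3 → V3 := fun s x => u (p s) x with huc_def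
  set ac : ℝ → T3 → ℝ := fun s x => a (p s) x with hac_def
  set Du : ℝ → T3 → Fin 3 → Fin 3 → ℝ :=
    fun s x j k => Torus.partialDeriv k (fun y => u (p s) y j) x with hDu_def
  set Dθ : ℝ → T3 → Fin 3 → ℝ := fun s x k => Torus.partialDeriv k (θ (p s)) x with hDθ_def
  set Ac : ℝ → T3 → Fin 3 → Fin 3 → ℝ := fun s x j k =>
    (θc s x)⁻¹ * (Du s x j k - if j = k then (∑ l, Du s x l l) / 3 else 0) with hAc_def
  set bc : ℝ → T3 → V3 := fun s x =>
    WithLp.toLp 2 fun k => Dθ s x k / (2 * θc s x ^ 2) with hbc_def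
  have hθc_pos : ∀ s x, 0 < θc s x := fun s x => hθpos (p s) (hpm s) x
  have hac_pos : ∀ s x, 0 < ac s x := fun s x => hapos (p s) (hpm s) x
  have hθm_c : ∀ s x, θm ≤ θc s x := fun s x => hθm (p s) (hpm s) x
  have hθM_c : ∀ s x, θc s x ≤ θM := fun s x => (abs_le.1 (hθM (p s) (hpm s) x)).2
  have hU_c : ∀ s x, ‖uc s x‖ ≤ U := fun s x => hU (p s) (hpm s) x
  have hDθ_bd : ∀ s x k, |Dθ s x k| ≤ MD := fun s x k => hMθ' k (p s) (hpm s) x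
  have hDu_bd : ∀ s x j k, |Du s x j k| ≤ MD := fun s x j k => hMu' j k (p s) (hpm s) x
  -- continuity of the clamped families (global, jointly)
  have hθc_c : Continuous (Function.uncurry θc) := continuous_clamp hpc hpm hθc0
  have huc_c : Continuous (Function.uncurry uc) := continuous_clamp hpc hpm huc0
  have hac_c : Continuous (Function.uncurry ac) := continuous_clamp hpc hpm hac
  have hθc_c' : Continuous fun q : ℝ × T3 => θc q.1 q.2 := by
    simpa only [Function.uncurry_def] using hθc_c
  have hDθ_c : ∀ k, Continuous fun q : ℝ × T3 => Dθ q.1 q.2 k := fun k => by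
    simpa only [Function.uncurry_def] using continuous_clamp hpc hpm (hDθ0 k)
  have hDu_c : ∀ j k, Continuous fun q : ℝ × T3 => Du q.1 q.2 j k := fun j k => by
    simpa only [Function.uncurry_def] using continuous_clamp hpc hpm (hDu0 j k)
  have hθinv : Continuous fun q : ℝ × T3 => (θc q.1 q.2)⁻¹ :=
    hθc_c'.inv₀ fun q => (hθc_pos q.1 q.2).ne'
  have hAc_c : Continuous (Function.uncurry Ac) := by
    refine continuous_pi fun j => continuous_pi fun k => ?_
    simp only [Function.uncurry_def, hAc_def]
    refine hθinv.mul ((hDu_c j k).sub ?_)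
    split_ifs
    · exact (continuous_finsetSum _ fun l _ => hDu_c l l).div_const _
    · exact continuous_const
  have hbc_c : Continuous (Function.uncurry bc) := by
    have h : ∀ k, Continuous fun q : ℝ × T3 => Dθ q.1 q.2 k / (2 * θc q.1 q.2 ^ 2) := fun k =>
      (hDθ_c k).div (continuous_const.mul (hθc_c'.pow 2)) fun q =>
        (mul_pos two_pos (pow_pos (hθc_pos q.1 q.2) 2)).ne'
    simp only [Function.uncurry_def, hbc_def]
    exact (PiLp.continuous_toLp 2 _).comp (continuous_pi h)
  -- bounds of the clamped coefficient families
  have hbc_bd : ∀ s x, ‖bc s x‖ ≤ 3 * (MD / (2 * θm ^ 2)) := fun s x => by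
    refine norm_le_three_mul (bc s x) fun k => ?_
    show |Dθ s x k / (2 * θc s x ^ 2)| ≤ MD / (2 * θm ^ 2)
    rw [abs_div, abs_of_pos (mul_pos two_pos (pow_pos (hθc_pos s x) 2))]
    exact div_le_div₀ hMD0 (hDθ_bd s x k) (mul_pos two_pos (pow_pos hθm0 2))
      (mul_le_mul_of_nonneg_left (pow_le_pow_left₀ hθm0.le (hθm_c s x) 2) two_pos.le)
  have hAc_bd : ∀ s x j k, |Ac s x j k| ≤ θm⁻¹ * (MD + MD) := by
    intro s x j k
    have hc : |(if j = k then (∑ l, Du s x l l) / 3 else 0 : ℝ)| ≤ MD := by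
      split_ifs
      · rw [abs_div, abs_of_pos (by norm_num : (0 : ℝ) < 3), Fin.sum_univ_three]
        have h0 := hDu_bd s x 0 0
        have h1 := hDu_bd s x 1 1
        have h2 := hDu_bd s x 2 2
        have h3 := abs_add_three (Du s x 0 0) (Du s x 1 1) (Du s x 2 2)
        linarith
      · rw [abs_zero]; exact hMD0
    show |(θc s x)⁻¹ * (Du s x j k - if j = k then (∑ l, Du s x l l) / 3 else 0)| ≤ _
    rw [abs_mul, abs_inv, abs_of_pos (hθc_pos s x)]
    exact mul_le_mul (inv_anti₀ hθm0 (hθm_c s x))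
      ((abs_sub _ _).trans (add_le_add (hDu_bd s x j k) hc)) (abs_nonneg _)
      (inv_nonneg.2 hθm0.le)
  have htr : ∀ s x, ∑ j, Ac s x j j = 0 := fun s x => trace_free (θc s x)⁻¹ (Du s x)
  -- (ii) the cut-off profile `G` of hypothesis 2 along the clamped families
  obtain ⟨G, hGc, ⟨CG, hCG⟩, hGagree, ⟨CF, hCF⟩, hO0, hO1, hO2⟩ :=
    hL θc uc bc hθc_c huc_c hbc_c ⟨θm, hθm0, hθm_c⟩ ⟨θM, hθM_c⟩ ⟨U, hU_c⟩
      ⟨3 * (MD / (2 * θm ^ 2)), hbc_bd⟩ Kstar hKstar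
  have hGsx : ∀ (s : ℝ) (x : T3), Continuous fun r : ℝ => G s (x, r) := fun s x =>
    hGc.comp (continuous_const.prodMk (continuous_const.prodMk continuous_id))
  -- (iii) the class hypotheses of KCWU for the member `Σ Ac w w + (bc·w) G`
  have hMA0 : 0 ≤ θm⁻¹ * (MD + MD) := mul_nonneg (inv_nonneg.2 hθm0.le) (by linarith)
  have hCB : ∀ (s : ℝ) (x : T3) (v : V3),
      |(∑ j, ∑ k, Ac s x j k * ((v - uc s x) j * (v - uc s x) k)) +
        (∑ j, bc s x j * (v - uc s x) j) * G s (x, ‖v - uc s x‖ ^ 2)| ≤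
        (9 * (θm⁻¹ * (MD + MD)) * (2 + 2 * U ^ 2) + CF) * (1 + ‖v‖ ^ 2) := by
    intro s x v
    refine (abs_add_le _ _).trans ?_
    have h2 : |(∑ j, bc s x j * (v - uc s x) j) * G s (x, ‖v - uc s x‖ ^ 2)| ≤
        CF * (1 + ‖v‖ ^ 2) := hCF s (x, v)
    have hS : ∑ j, ∑ k, |Ac s x j k| ≤ 9 * (θm⁻¹ * (MD + MD)) := by
      calc ∑ j, ∑ k, |Ac s x j k| ≤ ∑ j : Fin 3, ∑ k : Fin 3, θm⁻¹ * (MD + MD) :=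
            Finset.sum_le_sum fun j _ => Finset.sum_le_sum fun k _ => hAc_bd s x j k
        _ = 9 * (θm⁻¹ * (MD + MD)) := by simp only [Fin.sum_univ_three]; ring
    have hu2 : 2 + 2 * ‖uc s x‖ ^ 2 ≤ 2 + 2 * U ^ 2 := by
      nlinarith [hU_c s x, norm_nonneg (uc s x)]
    have hv : 0 ≤ 1 + ‖v‖ ^ 2 := by positivity
    have hq : |∑ j, ∑ k, Ac s x j k * ((v - uc s x) j * (v - uc s x) k)| ≤
        9 * (θm⁻¹ * (MD + MD)) * (2 + 2 * U ^ 2) * (1 + ‖v‖ ^ 2) :=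
      calc _ ≤ (∑ j, ∑ k, |Ac s x j k|) * (2 + 2 * ‖uc s x‖ ^ 2) * (1 + ‖v‖ ^ 2) :=
            quad_growth (uc s x) (Ac s x) v
        _ ≤ 9 * (θm⁻¹ * (MD + MD)) * (2 + 2 * ‖uc s x‖ ^ 2) * (1 + ‖v‖ ^ 2) :=
            mul_le_mul_of_nonneg_right (mul_le_mul_of_nonneg_right hS (by positivity)) hv
        _ ≤ 9 * (θm⁻¹ * (MD + MD)) * (2 + 2 * U ^ 2) * (1 + ‖v‖ ^ 2) :=
            mul_le_mul_of_nonneg_right (mul_le_mul_of_nonneg_left hu2 (by positivity)) hv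
    linarith
  have hOrth : ∀ (s : ℝ) (x : T3),
      (∫ v, ((∑ j, ∑ k, Ac s x j k * ((v - uc s x) j * (v - uc s x) k)) +
          (∑ j, bc s x j * (v - uc s x) j) * G s (x, ‖v - uc s x‖ ^ 2)) *
          localMaxwellian 1 (θc s x) (uc s x) v = 0) ∧
      (∀ k, ∫ v, ((∑ j, ∑ k, Ac s x j k * ((v - uc s x) j * (v - uc s x) k)) +
          (∑ j, bc s x j * (v - uc s x) j) * G s (x, ‖v - uc s x‖ ^ 2)) * v k *
          localMaxwellian 1 (θc s x) (uc s x) v = 0) ∧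
      ∫ v, ((∑ j, ∑ k, Ac s x j k * ((v - uc s x) j * (v - uc s x) k)) +
          (∑ j, bc s x j * (v - uc s x) j) * G s (x, ‖v - uc s x‖ ^ 2)) * ‖v‖ ^ 2 *
          localMaxwellian 1 (θc s x) (uc s x) v = 0 := fun s x =>
    member_orth (hθc_pos s x) (uc s x) (A := Ac s x) (htr s x) (bc s x)
      (Gx := fun r => G s (x, r)) (hGsx s x) (CF := CF) (fun v => hCF s (x, v))
      (hO0 s x) (hO1 s x) (hO2 s x)
  have hguard_c : ∀ s ∈ Icc 0 t₁, σ ^ 3 * (⨆ x, ac s x) ≤ η₀ * ∫ x, ac s x := fun s hs => by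
    simp only [hac_def, hpid s hs]; exact hguard s hs
  -- (iv) KCWU along the clamped families
  obtain ⟨β₀, hβ₀, hβ⟩ := hKC t₁ ac θc uc hac_c hθc_c huc_c hac_pos hθc_pos σ hσ hguard_c Φ
    Ac bc G hAc_c hbc_c hGc ⟨_, fun s _ y => hCB s y.1 y.2⟩ (fun s _ x => (hOrth s x).1)
    (fun s _ x j => (hOrth s x).2.1 j) (fun s _ x => (hOrth s x).2.2)
  refine ⟨G, hGc.continuousOn, ⟨CG, fun s _ y hy => hCG s y hy⟩, fun s hs x s' hs' => ?_,
    β₀, hβ₀, fun β hββ ε hε => ?_⟩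
  · rw [hGagree s x s' hs']
    simp only [hθc_def, hpid s hs]
  · obtain ⟨τ₀, hτ₀, hτ⟩ := hβ β hββ ε hε
    refine ⟨τ₀, hτ₀, fun τ hττ => ?_⟩
    obtain ⟨N₀, hN⟩ := hτ τ hττ
    refine ⟨N₀, fun N hNN s hs => ?_⟩
    have hfin := hN N hNN s hs
    simpa only [hac_def, hθc_def, huc_def, hAc_def, hbc_def, hDu_def, hDθ_def, hpid s hs,
      PiLp.toLp_apply, traceless_form] using hfin

end Summit.AtomisticToContinuum.HydrodynamicLimit.Theorems.ClampedCurrentsDockKineticInstance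

end
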